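import Summits.QuantumFields.YangMills.Theorems.BalabanUVNodesN16HolderEnd
import HarnessLib

/-!
# Route «BalabanUVNodes», cluster K4 «SpineRates» — node N16 = NE3: THE END WITH THE MULTI-SCALE (3.40) HÖLDER MEMBER (repair R-β″, PRODUCER HALF,
# the junction): the slice-generic endpoint-chart END and the junction on [B8]'s surface with the multi-scale member carried (per pair, along every lattice
# line, `1 ≤ j ≤ L^k`) instead of its nearest-neighbour reading — generation 2's `N16HolderEnd` §1–§2 with the third covariant conjunct MULTI-SCALE

Cell `pub-ymgap`, seat `pub-ymgap-dag-n16-c` (R134 fan-out seat, strategy s1; HUMAN RULING D-0062; chair R424 venue), generation 4, file 25.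
`--supports stmt-QuantumFields-19912 --as helper` (K3‴ `SpineGivenEndpointR13`, route rev 16; lineage K3′ 19908).  `bears_on: R4∕N16 · edge N05 → N16`.
Located item: `HOME/pub-ymgap-dag-n16-c/LOCATED-N16-HOLDER-PIN.md`, census row R-β″ (ADDENDUM 5); consumer half files 20∕21, definitions file 22 (`CovRootHolderMS`),
producer bricks files 23∕24 (`N16HolderMSDictionary` ∕ `N16HolderMSReadouts`).

WHY.  THE END of row NE3 passes the third covariant conjunct of the B8 representative THROUGH (generation 2's observation: the energy conjunct is β-free,
`energyNormW_le_of_endpointChart_slice`; the two covariant conjuncts of the chart's start `Γ 0` are hypotheses returned verbatim).  So it passes the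
MULTI-SCALE member through as well: THIS FILE is `N16HolderEnd.covRoot_holder_of_endpointChart_slice` ∕ `…_of_pairLandauGaugeB8Avg` with the nearest-neighbour
conjunct «‖Ad (W (y+e κ) μ) (Ad (W (y+e κ+e μ) μ) (Z (y+2•e μ) κ) − Z (y+e μ) κ) − (…)‖ ≤ Λ₂′ξ^{2+β}» REPLACED by the multi-scale one «∀ 1 ≤ j ≤ L^k,
‖Ad (line holonomy from y+e κ, j steps) (Ad (W (y+e κ+j•e μ) μ) (Z (y+(j+1)•e μ) κ) − Z (y+j•e μ) κ) − (Ad (W (y+e κ) μ) (Z (y+e μ) κ) − Z y κ)‖ ≤ Λ₂′ξ^{2+β}j^β»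
(the body of `N16HolderMSDefs.CovRootHolderMS`), and the B8-surface hypothesis `PairLandauGaugeB8Avg … s₁ s₂ β dom` REPLACED by its multi-scale companion,
written inline: per pair `∃ (u, Z)`, `LandauRepB8Avg L N k W U_A u Z s₁ s₂ β` AND the multi-scale member of `Z` with constant `s₂` (what the multi-scale twins of
(OUT_print) → `LandauRepB8` produce from node N05's leaf through bricks 1–2).  Same proofs, token for token.

WHAT THIS FILE PROVES (kernel, theorems only, 0 `def`, 0 sorry):
§1 `covRoot_holderMS_of_endpointChart_slice` — the slice-generic END with the multi-scale third conjunct (class-generic; `d ≥ 1`, `L, N ≥ 1`).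
§2 `covRoot_holderMS_of_pairLandauGaugeB8AvgMS` — THE END's junction: the multi-scale B8 shape ∧ (per pair, per representative) `DecomposedRepT` on `slicB8` ∧
   (P♮)∕(RES♯) on `slicB8` ∧ k-free letters ⟹ the eight-conjunct multi-scale β-root body (`Λ₁ = s₁`, `Λ₂′ = s₂`) — the hypothesis `h` of
   `N16HolderMultiScaleRates.closeness_of_covRoot_holderMS` ∕ the body of `CovRootHolderMS d 𝒞 L N b g C s₁ s₂ β dom`.
HONEST FRAMING: kernel bookkeeping over landed modules; the multi-scale B8 shape and the chart data are HYPOTHESES; nothing of Bałaban's proved; NE3 ∕ N16 NOT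
discharged; count-neutral; one finite four-torus at fixed ε — NOT ℝ⁴, NOT infinite volume, NOT OS, NOT a mass gap, NOT Clay.
-/

set_option autoImplicit false

open scoped BigOperators Matrix Matrix.Norms.L2Operator
open NormedSpace Finset

namespace Summit.QuantumFields.YangMills.BalabanUVNodes.N16HolderMSEnd

open Set
open Literature.MathematicalPhysics.QuantumFieldTheory.Balaban1983to89
open B7Prop1Explicit B7Prop2Explicit
open T4AveragingDeficitWall hiding Site Plane Plaq Bond
open T4AveragingDeficitWallBoundary (periodBox)
open Summit.QuantumFields.BalabanUV.T4Continuum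
open AveragingDeficitPeriodicCounting (IsPeriodicDir)
open AveragingDeficitChartCalculus (cavg)
open MinimalActionSandwich (IsMinimiser)
open MinimalActionRate (Regular)
open NE3EnergyShapes (residualScale residualScale_nonneg IsUnitarySite IsPeriodicSite)
open NE3EnergyWeightedShapes (energyNormW CurlPairedResidual)
open NE3SlicePoincareShape (SlicePoincare)
open NE3EndpointChart (EndpointChart)
open NE3EnergyRateWSupOfSlicePoincare (cLambda)
open NE3EnergyRateWCovOfEndpointChart (energyNormW_le_of_endpointChart_slice)
open NE3ProductPath (pathΓ)
open NE3ProductPathChartSlice (DecomposedRepT endpointChart_of_decomposedRepT)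
open NE3EndpointPackageOfDecomposedRep (extPath extPath_of_mem mem_window_of_mem_Icc isSkewDir_extPath isPeriodicDir_extPath norm_extPath_le
  endpointChart_congr_path)
open NE3.PairLandauB8 (LandauRepB8)
open NE3.PairLandauB8Avg (LandauRepB8Avg PairLandauGaugeB8Avg slicB8 skew_of_mem_slicB8 periodic_of_mem_slicB8)

noncomputable section

variable {d : ℕ} {n : Type*} [Fintype n] [DecidableEq n]

/-! ## §1 The slice-generic END at exponent `β` -/

/-- **THE COVARIANT ROOT WITH THE MULTI-SCALE HÖLDER MEMBER FROM ENDPOINT CHARTS ON ANY DIRECTION SETS** (`N16HolderEnd.covRoot_holder_of_endpointChart_slice` with the third covariant conjunct multi-scale; original docstring follows). (class-generic; `d ≥ 1`, `L, N ≥ 1`):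
`Support/NE3EnergyRateWCovOfEndpointChart.ne3EnergyRateWCov_of_endpointChart_slice` with its last hypothesis and the third conjunct of its conclusion at
exponent `(2:ℝ)+β` instead of `3`.  Per pair: an endpoint chart on `T` (skew, periodic members) in the weighted norm, sup-radius `α`, plaquette radius `a`,
(P♮) `SlicePoincare … CP`, (RES♯) `CurlPairedResidual … (C′·residualScale …)`, the two regularity inequalities, and for the chart's start `Γ 0` the covariant
conjuncts (Lip₁ᶜ) `≤ Λ₁ξ²`, (Lip₂′ᶜ)_β `≤ Λ₂′ξ^{2+β}`; budget `2Λθ + Λθ² + κ + 2q ≤ cΛ∕2`.  THEN for every `k ≥ 1`, datum and minimiser pair: `∃ (u, Z)`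
(:= `(u, Γ 0)`) unitary∕periodic, skew∕periodic, `gaugeAct u U_A = vary W Z 1`, `energyNormW … ≤ (1+θ₀)(4∕cΛ)C′·residualScale …`, (Lip₁ᶜ), (Lip₂′ᶜ)_β.
The energy conjunct is `energyNormW_le_of_endpointChart_slice` BY NAME; the covariant conjuncts are passed through. [folklore] -/
theorem covRoot_holderMS_of_endpointChart_slice [Nonempty n] (hd : 1 ≤ d) {𝒞 : ℕ → Set (Site d → Fin d → (Matrix n n ℂ)ˣ)}
    {L N : ℕ} (hL : 1 ≤ L) (hN : 1 ≤ N) {b g : ℝ} {dom : Set (Site d → Fin d → (Matrix n n ℂ)ˣ)}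
    {CP Λ θ κ θ₀ q C' Λ₁ Λ₂' β : ℝ}
    (hCP : 0 ≤ CP) (hreg₁ : CP * (Real.sqrt Λ - 1) ^ 2 ≤ 1 / 4) (hθ₀ : 0 ≤ θ₀) (hC' : 0 ≤ C')
    (hbudget : 2 * Λ * θ + Λ * θ ^ 2 + κ + 2 * q ≤ cLambda n CP Λ / 2)
    (hchart : ∀ k : ℕ, 1 ≤ k → ∀ V ∈ dom, ∀ UA UB : Site d → Fin d → (Matrix n n ℂ)ˣ,
      IsMinimiser d 𝒞 L N k V UA → IsMinimiser d 𝒞 L N (k + 1) V UB → Regular d L N b g (k + 1) UB →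
        IsUnitaryCfg (cavg L UB) ∧
        ∃ (T : Set (Site d → Fin d → Matrix n n ℂ)) (u : Site d → (Matrix n n ℂ)ˣ)
          (Γ Ψ Ψ' : ℝ → Site d → Fin d → Matrix n n ℂ) (Xref : Site d → Fin d → Matrix n n ℂ) (α a : ℝ),
          (∀ Y ∈ T, IsSkewDir Y) ∧ (∀ Y ∈ T, IsPeriodicDir Y ((N * L ^ k : ℕ) : ℤ)) ∧ 0 ≤ α ∧ 0 ≤ a ∧
          EndpointChart 𝒞 L N k V UA UB u Γ Ψ Ψ' Xref T
            (fun Y => energyNormW L k (cavg L UB) Y (periodBox (N * L ^ k))) θ κ θ₀ q a ∧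
          (∀ t (x : Site d) (μ : Fin d), ‖Γ t x μ‖ ≤ α) ∧
          (1 + 24 * Real.sqrt d * (Real.exp α - 1) * (L : ℝ) ^ k) ^ 2 + 48 * d * a * ((L : ℝ) ^ k) ^ 2 ≤ Λ ∧
          112 * (d : ℝ) * a * CP * ((L : ℝ) ^ k) ^ 2 ≤ 1 / (2 * (Fintype.card n : ℝ)) ∧
          SlicePoincare L k (cavg L UB) T CP (periodBox (N * L ^ k)) ∧
          CurlPairedResidual L k (cavg L UB) T (C' * residualScale d L N b g k) (periodBox (N * L ^ k)) ∧
          (∀ (κ : Fin d) (x : Site d) (μ : Fin d),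
            ‖Ad (cavg L UB (x + e κ) μ) (Γ 0 (x + e μ) κ) - Γ 0 x κ‖ ≤ Λ₁ * (((L : ℝ)⁻¹) ^ k) ^ 2) ∧
          (∀ (κ μ : Fin d) (y : Site d) (j : ℕ), 1 ≤ j → j ≤ L ^ k →
            ‖Ad (((List.range j).map fun i : ℕ => cavg L UB (y + e κ + i • e μ) μ).prod)
                  (Ad (cavg L UB (y + e κ + j • e μ) μ) (Γ 0 (y + (j + 1) • e μ) κ) - Γ 0 (y + j • e μ) κ)
              - (Ad (cavg L UB (y + e κ) μ) (Γ 0 (y + e μ) κ) - Γ 0 y κ)‖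
              ≤ Λ₂' * (((L : ℝ)⁻¹) ^ k) ^ ((2 : ℝ) + β) * (j : ℝ) ^ β)) :
    ∀ k : ℕ, 1 ≤ k → ∀ V ∈ dom, ∀ UA UB : Site d → Fin d → (Matrix n n ℂ)ˣ,
      IsMinimiser d 𝒞 L N k V UA → IsMinimiser d 𝒞 L N (k + 1) V UB → Regular d L N b g (k + 1) UB →
        ∃ (u : Site d → (Matrix n n ℂ)ˣ) (Z : Site d → Fin d → Matrix n n ℂ),
          IsUnitarySite u ∧ IsPeriodicSite u ((N * L ^ k : ℕ) : ℤ) ∧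
          IsSkewDir Z ∧ IsPeriodicDir Z ((N * L ^ k : ℕ) : ℤ) ∧
          gaugeAct u UA = vary (rescale L (bavg L UB)) Z 1 ∧
          energyNormW L k (rescale L (bavg L UB)) Z (periodBox (N * L ^ k))
            ≤ ((1 + θ₀) * (4 / cLambda n CP Λ) * C') * residualScale d L N b g k ∧
          (∀ (κ : Fin d) (x : Site d) (μ : Fin d),
            ‖Ad (rescale L (bavg L UB) (x + e κ) μ) (Z (x + e μ) κ) - Z x κ‖ ≤ Λ₁ * (((L : ℝ)⁻¹) ^ k) ^ 2) ∧
          (∀ (κ μ : Fin d) (y : Site d) (j : ℕ), 1 ≤ j → j ≤ L ^ k →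
            ‖Ad (((List.range j).map fun i : ℕ => rescale L (bavg L UB) (y + e κ + i • e μ) μ).prod)
                  (Ad (rescale L (bavg L UB) (y + e κ + j • e μ) μ) (Z (y + (j + 1) • e μ) κ) - Z (y + j • e μ) κ)
              - (Ad (rescale L (bavg L UB) (y + e κ) μ) (Z (y + e μ) κ) - Z y κ)‖
              ≤ Λ₂' * (((L : ℝ)⁻¹) ^ k) ^ ((2 : ℝ) + β) * (j : ℝ) ^ β) := by
  intro k hk V hV UA UB hA hB hreg
  obtain ⟨hW, T, u, Γ, Ψ, Ψ', Xref, α, a, hskewT, hperT, hα, ha, hpath, hΓα, hΛw, hreg₂, hP, hres, h1, h2⟩ :=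
    hchart k hk V hV UA UB hA hB hreg
  have hr : 0 ≤ C' * residualScale d L N b g k := mul_nonneg hC' (residualScale_nonneg d L N b g k)
  obtain ⟨hend, -⟩ := energyNormW_le_of_endpointChart_slice hd hL hN hW hskewT hperT hCP hreg₁ hθ₀ hr hbudget hα ha hpath
    hΓα hΛw hreg₂ hP hres hA
  have hcv : cavg L UB = rescale L (bavg L UB) := rfl
  rw [hcv] at hend h1 h2
  refine ⟨u, Γ 0, hpath.gauge.1, hpath.gauge.2, hpath.skew 0, hpath.per 0, hpath.rep, ?_, h1, h2⟩
  refine hend.trans (le_of_eq ?_)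
  ring

/-! ## §2 THE END's junction on [B8]'s surface at exponent `β` -/

/-- **THE END ON B8's SURFACE WITH THE MULTI-SCALE MEMBER** (`N16HolderEnd.covRoot_holder_of_pairLandauGaugeB8Avg` with the B8 shape's third member and the root's third conjunct multi-scale; original docstring follows). The β-root ⇐ `PairLandauGaugeB8Avg … s₁ s₂ β` ∧ (per pair, per representative) `DecomposedRepT` ON `slicB8`
STARTING AT THE B8 DIRECTION ∧ (P♮)∕(RES♯) ON `slicB8` ∧ k-FREE LETTERS** (class-generic; `d ≥ 1`, `L, N ≥ 1`): `Spine/NE3/PairLandauB8End.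
ne3EnergyRateWCov_of_pairLandauGaugeB8Avg` with the B8 shape at exponent `β` ([Balaban1985RegularSpaces] (1.36) «β ≦ β₀ < 1») and the conclusion the
β-root (`Λ₁ = s₁`, `Λ₂′ = s₂`, `C = (1 + (ν + 23√2·√(16d+1)·(1+ν)))·(4∕cΛ)·C′`).  Same proof: product-path chart on `slicB8`, zero-extension of its path,
§1; `LandauRepB8.grad` and `LandauRepB8.holder` VERBATIM for the two covariant conjuncts. [folklore] -/
theorem covRoot_holderMS_of_pairLandauGaugeB8AvgMS [Nonempty n] (hd : 1 ≤ d) {𝒞 : ℕ → Set (Site d → Fin d → (Matrix n n ℂ)ˣ)}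
    {L N : ℕ} (hL : 1 ≤ L) (hN : 1 ≤ N) {b g s₁ s₂ β : ℝ} {dom : Set (Site d → Fin d → (Matrix n n ℂ)ˣ)}
    {ν κ₁ κ₂ CP Λ C' : ℝ} (hCP : 0 ≤ CP) (hreg₁ : CP * (Real.sqrt Λ - 1) ^ 2 ≤ 1 / 4) (hν : 0 ≤ ν) (hC' : 0 ≤ C')
    (hbudget : 2 * Λ * (2 * (1 + 4 * Real.sqrt (16 * d + 1)) * ν) + Λ * (2 * (1 + 4 * Real.sqrt (16 * d + 1)) * ν) ^ 2
        + (2 * κ₁ + 912 * d * κ₂) ≤ cLambda n CP Λ / 2)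
    (hB8 : ∀ k : ℕ, 1 ≤ k → ∀ V ∈ dom, ∀ UA UB : Site d → Fin d → (Matrix n n ℂ)ˣ,
      IsMinimiser d 𝒞 L N k V UA → IsMinimiser d 𝒞 L N (k + 1) V UB → Regular d L N b g (k + 1) UB →
      ∃ (u : Site d → (Matrix n n ℂ)ˣ) (Z : Site d → Fin d → Matrix n n ℂ), LandauRepB8Avg L N k (cavg L UB) UA u Z s₁ s₂ β ∧
        ∀ (κ μ : Fin d) (y : Site d) (j : ℕ), 1 ≤ j → j ≤ L ^ k →
          ‖Ad (((List.range j).map fun i : ℕ => cavg L UB (y + e κ + i • e μ) μ).prod)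
                (Ad (cavg L UB (y + e κ + j • e μ) μ) (Z (y + (j + 1) • e μ) κ) - Z (y + j • e μ) κ)
            - (Ad (cavg L UB (y + e κ) μ) (Z (y + e μ) κ) - Z y κ)‖ ≤ s₂ * (((L : ℝ)⁻¹) ^ k) ^ ((2 : ℝ) + β) * (j : ℝ) ^ β)
    (hsupp : ∀ k : ℕ, 1 ≤ k → ∀ V ∈ dom, ∀ UA UB : Site d → Fin d → (Matrix n n ℂ)ˣ,
      IsMinimiser d 𝒞 L N k V UA → IsMinimiser d 𝒞 L N (k + 1) V UB → Regular d L N b g (k + 1) UB →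
      ∀ (u : Site d → (Matrix n n ℂ)ˣ) (Z : Site d → Fin d → Matrix n n ℂ), LandauRepB8Avg L N k (cavg L UB) UA u Z s₁ s₂ β →
        IsUnitaryCfg (cavg L UB) ∧
        ∃ (X Nn : Site d → Fin d → Matrix n n ℂ) (α αN a : ℝ),
          DecomposedRepT 𝒞 L N k V UA UB u X Nn (slicB8 L N k (cavg L UB)) α αN ν κ₁ κ₂ a ∧
          pathΓ X Nn 0 = Z ∧ α ≤ 1 / 40 ∧ αN ≤ 1 / 100 ∧
          (1 + 24 * Real.sqrt d * (Real.exp (10 * (α + αN)) - 1) * (L : ℝ) ^ k) ^ 2 + 48 * d * a * ((L : ℝ) ^ k) ^ 2 ≤ Λ ∧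
          112 * (d : ℝ) * a * CP * ((L : ℝ) ^ k) ^ 2 ≤ 1 / (2 * (Fintype.card n : ℝ)) ∧
          SlicePoincare L k (cavg L UB) (slicB8 L N k (cavg L UB)) CP (periodBox (N * L ^ k)) ∧
          CurlPairedResidual L k (cavg L UB) (slicB8 L N k (cavg L UB)) (C' * residualScale d L N b g k) (periodBox (N * L ^ k))) :
    ∀ k : ℕ, 1 ≤ k → ∀ V ∈ dom, ∀ UA UB : Site d → Fin d → (Matrix n n ℂ)ˣ,
      IsMinimiser d 𝒞 L N k V UA → IsMinimiser d 𝒞 L N (k + 1) V UB → Regular d L N b g (k + 1) UB →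
        ∃ (u : Site d → (Matrix n n ℂ)ˣ) (Z : Site d → Fin d → Matrix n n ℂ),
          IsUnitarySite u ∧ IsPeriodicSite u ((N * L ^ k : ℕ) : ℤ) ∧
          IsSkewDir Z ∧ IsPeriodicDir Z ((N * L ^ k : ℕ) : ℤ) ∧
          gaugeAct u UA = vary (rescale L (bavg L UB)) Z 1 ∧
          energyNormW L k (rescale L (bavg L UB)) Z (periodBox (N * L ^ k))
            ≤ ((1 + (ν + 23 * Real.sqrt 2 * Real.sqrt (16 * d + 1) * (1 + ν))) * (4 / cLambda n CP Λ) * C') * residualScale d L N b g k ∧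
          (∀ (κ : Fin d) (x : Site d) (μ : Fin d),
            ‖Ad (rescale L (bavg L UB) (x + e κ) μ) (Z (x + e μ) κ) - Z x κ‖ ≤ s₁ * (((L : ℝ)⁻¹) ^ k) ^ 2) ∧
          (∀ (κ μ : Fin d) (y : Site d) (j : ℕ), 1 ≤ j → j ≤ L ^ k →
            ‖Ad (((List.range j).map fun i : ℕ => rescale L (bavg L UB) (y + e κ + i • e μ) μ).prod)
                  (Ad (rescale L (bavg L UB) (y + e κ + j • e μ) μ) (Z (y + (j + 1) • e μ) κ) - Z (y + j • e μ) κ)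
              - (Ad (rescale L (bavg L UB) (y + e κ) μ) (Z (y + e μ) κ) - Z y κ)‖
              ≤ s₂ * (((L : ℝ)⁻¹) ^ k) ^ ((2 : ℝ) + β) * (j : ℝ) ^ β) := by
  have hθ₀ : 0 ≤ ν + 23 * Real.sqrt 2 * Real.sqrt (16 * d + 1) * (1 + ν) := by positivity
  have hbudget' : 2 * Λ * (2 * (1 + 4 * Real.sqrt (16 * d + 1)) * ν) + Λ * (2 * (1 + 4 * Real.sqrt (16 * d + 1)) * ν) ^ 2
      + (2 * κ₁ + 912 * d * κ₂) + 2 * 0 ≤ cLambda n CP Λ / 2 := by simpa using hbudget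
  refine covRoot_holderMS_of_endpointChart_slice hd hL hN hCP hreg₁ hθ₀ hC' hbudget' ?_
  intro k hk V hV UA UB hA hB hreg
  obtain ⟨u, Z, hZ, hMS⟩ := hB8 k hk V hV UA UB hA hB hreg
  obtain ⟨hW, X, Nn, α, αN, a, hdec, hΓ0, hα, hαN, hJ1, hJ2, hP, hres⟩ := hsupp k hk V hV UA UB hA hB hreg u Z hZ
  -- the product-path chart on `slicB8`, then the zero-extension of its path (global sup `10(α+αN)`)
  have hchart := endpointChart_of_decomposedRepT hL hN hW hdec
  have hchart' := endpointChart_congr_path (Γ' := extPath X Nn) hchart (fun t ht => extPath_of_mem ht) (isSkewDir_extPath X Nn)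
    (isPeriodicDir_extPath hdec.perX hdec.perN)
  have hsup : ∀ t (x : Site d) (μ : Fin d), ‖extPath X Nn t x μ‖ ≤ 10 * (α + αN) :=
    fun t x μ => norm_extPath_le hdec.skewX hdec.skewN hdec.supX hdec.supN hα hαN t x μ
  have hα' : 0 ≤ 10 * (α + αN) := by linarith [hdec.hα0, hdec.hαN0]
  -- the extended path starts at the B8 direction
  have h0 : extPath X Nn 0 = Z := by
    rw [extPath_of_mem (mem_window_of_mem_Icc ⟨le_rfl, zero_le_one⟩), hΓ0]
  refine ⟨hW, slicB8 L N k (cavg L UB), u, extPath X Nn, _, _, X, 10 * (α + αN), a,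
    fun Y hY => skew_of_mem_slicB8 hY, fun Y hY => periodic_of_mem_slicB8 hY, hα', hdec.ha, hchart', hsup, hJ1, hJ2, hP, hres, ?_, ?_⟩
  · intro κ x μ
    rw [h0]
    exact hZ.grad κ x μ
  · intro κ μ y j hj hjL
    rw [h0]
    exact hMS κ μ y j hj hjL

end

end Summit.QuantumFields.YangMills.BalabanUVNodes.N16HolderMSEnd
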